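import Summits.QuantumFields.YangMills.Theorems.EquipartitionCriticalityEquipartitionPinsProbeTangentSteinFiniteBeta
import Summits.QuantumFields.YangMills.Theorems.EquipartitionCriticalityEquipartitionPinsProbeTangentSteinSingleEdgeLimit
import Summits.QuantumFields.YangMills.Theorems.EquipartitionCriticalityEquipartitionPinsProbeTangentSteinReduction
import Summits.QuantumFields.YangMills.Theorems.EquipartitionCriticalityEquipartitionPinsProbeTangentExtraction
import Summits.QuantumFields.YangMills.Theorems.EquipartitionCriticalityEquipartitionPinsProbeTangentClosedLimit
import Summits.QuantumFields.YangMills.Theorems.EquipartitionCriticalityEquipartitionPinsProbeTangentCurlClosed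
import Summits.QuantumFields.YangMills.Theorems.EquipartitionCriticalityEquipartitionPinsProbeTangentEnergyLaw
import Summits.QuantumFields.YangMills.Theorems.EquipartitionCriticalityEquipartitionPinsProbeTangentSecondMoments
import Summits.QuantumFields.YangMills.Theorems.EquipartitionCriticalityEquipartitionPinsProbeTangentFieldMoments
import Summits.QuantumFields.YangMills.Theorems.EquipartitionCriticalityEquipartitionPinsProbeTangentPlaqFieldContinuous
import Summits.QuantumFields.YangMills.Theorems.EquipartitionCriticalityEquipartitionPinsProbeLiePos
import HarnessLib

/-!
# Tangent laws of the rescaled plaquette field (crux `stmt-QuantumFields-8760`, line `Sketch`)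

Route `EquipartitionCriticality` of `YangMills`, crux `EquipartitionPinsProbe`, line `Sketch`. This file
assembles the landed T-stubs of the line into the three statements the local free-gluon law consumes:

* `stub_steinLimit` (T3'): the trigonometric Stein (linearised Schwinger–Dyson) identity of every tangent
  law `τ` of the rescaled plaquette field `Y^β = dA^β` (comb gauge) along `β_k → ∞` — from the finite-`β`
  single-edge identities (TS7 `stub_steinFiniteBeta`), their passage to the weak limit (TS8
  `stub_steinSingleEdgeLimit`, with the moment bounds TM `stub_fieldMoments`, T2' `stub_secondMoments`)
  and the reduction of general finitely supported `α` to single edges (TS9 `stub_steinReduction`);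
* `stub_tangentCore` (T_main): along any `β_k → ∞`, torus-limit states have a subsequential tangent law
  with (T0) the energies following the field (T0' `stub_energyLaw`), (T1) closedness (TK `stub_curlClosed`,
  TW `stub_closedLimit`), (T2) the moment bounds and the budget (T2'), (T3) the Stein identity — the
  extraction is TX `stub_extraction` fed by TM;
* `stub_tangent` (T): the same with `D = dim 𝔤_r > 0` (`stub_liePos`).

Reference: S. Chatterjee, arXiv:1602.01222 §§9–14 (axial gauge, lattice Maxwell tangent). [arXiv160201222]
-/

noncomputable section

open MeasureTheory Filter Topology

namespace Summit.QuantumFields.YangMills.Theorems.EquipartitionPinsProbe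

/-- STUB T3' of line `Sketch` (crux `stmt-QuantumFields-8760`) — **the Stein identity of a tangent law** (T3; the `β → ∞` limit of the differentiated skew
Haar-shift identity, held by the lead): along `β_k → ∞`, `μ_k ∈ infiniteVolumeLimitPoints r.ρ β_k` with
`law(Y^{β_k}) → τ` weakly, `E_τ[cos⟨Y,h⟩⟨Y,dα⟩] = −⟨dα,h⟩E_τ[sin⟨Y,h⟩]` and the companion identity, for
finitely supported `h`, `α` (linearity in `α`; for `α = δ_e ⊗ e_a` differentiate STUB TS2 at `s = 0` along
`k_s = expChart(s e_a/√β)` with STUB TS0: `∂_s Y = dδ_e ⊗ e_a + O(‖V − 1‖)` by STUB TK, and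
`β ∂_s S_e = ⟨Y, dδ_e ⊗ e_a⟩ + o(1)` in `L¹` by STUBS TA, TM; pass to the limit with uniform integrability). -/
theorem stub_steinLimit :
    ∀ (G : Type) [Group G] [TopologicalSpace G] [IsTopologicalGroup G] [CompactSpace G],
      Literature.MathematicalPhysics.QuantumFieldTheory.IsCompactSimpleLieGroup G →
      letI : MeasurableSpace G := borel G; haveI : BorelSpace G := ⟨rfl⟩;
      ∀ r : Literature.MathematicalPhysics.QuantumFieldTheory.LatticeRep G,
        (∀ ε : ℝ, 0 < ε → ∀ᶠ β : ℝ in Filter.atTop,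
          ∀ μ ∈ Literature.MathematicalPhysics.QuantumLattice.infiniteVolumeLimitPoints (d := 4) r.ρ β,
            |β * (∫ U, (∑ i : Fin 4, ∑ j : Fin 4,
                if i < j then ((r.N : ℝ) - Literature.MathematicalPhysics.QuantumLattice.plaquetteObs r.ρ 0 i j U) else 0) ∂μ) -
              3 * (Summit.QuantumFields.YangMills.Theorems.EquipartitionPinsProbe.lieDim r : ℝ) / 2| < ε) →
        ∀ (β : ℕ → ℝ) (μ : ℕ → MeasureTheory.Measure (Literature.MathematicalPhysics.QuantumLattice.LGConfig 4 G)),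
          Filter.Tendsto β Filter.atTop Filter.atTop →
          (∀ k, μ k ∈ Literature.MathematicalPhysics.QuantumLattice.infiniteVolumeLimitPoints (d := 4) r.ρ (β k)) →
          ∀ τ : MeasureTheory.Measure (Literature.MathematicalPhysics.QuantumLattice.ZdPlaquette 4 → Fin (Summit.QuantumFields.YangMills.Theorems.EquipartitionPinsProbe.lieDim r) → ℝ),
            MeasureTheory.IsProbabilityMeasure τ →
            (∀ f : (Literature.MathematicalPhysics.QuantumLattice.ZdPlaquette 4 → Fin (Summit.QuantumFields.YangMills.Theorems.EquipartitionPinsProbe.lieDim r) → ℝ) → ℝ, Continuous f →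
                (∃ C : ℝ, ∀ Y, |f Y| ≤ C) →
              Filter.Tendsto (fun k : ℕ => ∫ U, f (Summit.QuantumFields.YangMills.Theorems.EquipartitionPinsProbe.plaqField r (β k) U) ∂(μ k)) Filter.atTop
                (nhds (∫ Y, f Y ∂τ))) →
            ∀ (S : Finset (Literature.MathematicalPhysics.QuantumLattice.ZdPlaquette 4)) (E : Finset (Literature.MathematicalPhysics.QuantumLattice.ZdEdge 4))
              (h : Literature.MathematicalPhysics.QuantumLattice.ZdPlaquette 4 → Fin (Summit.QuantumFields.YangMills.Theorems.EquipartitionPinsProbe.lieDim r) → ℝ)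
              (α : Literature.MathematicalPhysics.QuantumLattice.ZdEdge 4 → Fin (Summit.QuantumFields.YangMills.Theorems.EquipartitionPinsProbe.lieDim r) → ℝ),
              (∀ e, e ∉ E → α e = 0) →
              (∀ p, p ∉ S → ∀ a : Fin (Summit.QuantumFields.YangMills.Theorems.EquipartitionPinsProbe.lieDim r),
                Literature.MathematicalPhysics.QuantumFieldTheory.plaquetteCurl (fun e => α e a) p = 0) →
              (∫ Y, Real.cos (∑ p ∈ S, ∑ a : Fin (Summit.QuantumFields.YangMills.Theorems.EquipartitionPinsProbe.lieDim r), h p a * Y p a) *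
                  (∑ p ∈ S, ∑ a : Fin (Summit.QuantumFields.YangMills.Theorems.EquipartitionPinsProbe.lieDim r),
                    Literature.MathematicalPhysics.QuantumFieldTheory.plaquetteCurl (fun e => α e a) p * Y p a) ∂τ =
                -(∑ p ∈ S, ∑ a : Fin (Summit.QuantumFields.YangMills.Theorems.EquipartitionPinsProbe.lieDim r),
                    Literature.MathematicalPhysics.QuantumFieldTheory.plaquetteCurl (fun e => α e a) p * h p a) *
                  ∫ Y, Real.sin (∑ p ∈ S, ∑ a : Fin (Summit.QuantumFields.YangMills.Theorems.EquipartitionPinsProbe.lieDim r), h p a * Y p a) ∂τ) ∧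
              (∫ Y, Real.sin (∑ p ∈ S, ∑ a : Fin (Summit.QuantumFields.YangMills.Theorems.EquipartitionPinsProbe.lieDim r), h p a * Y p a) *
                  (∑ p ∈ S, ∑ a : Fin (Summit.QuantumFields.YangMills.Theorems.EquipartitionPinsProbe.lieDim r),
                    Literature.MathematicalPhysics.QuantumFieldTheory.plaquetteCurl (fun e => α e a) p * Y p a) ∂τ =
                (∑ p ∈ S, ∑ a : Fin (Summit.QuantumFields.YangMills.Theorems.EquipartitionPinsProbe.lieDim r),
                    Literature.MathematicalPhysics.QuantumFieldTheory.plaquetteCurl (fun e => α e a) p * h p a) *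
                  ∫ Y, Real.cos (∑ p ∈ S, ∑ a : Fin (Summit.QuantumFields.YangMills.Theorems.EquipartitionPinsProbe.lieDim r), h p a * Y p a) ∂τ) := by
  intro G _ _ _ _ hG
  letI : MeasurableSpace G := borel G
  haveI : BorelSpace G := ⟨rfl⟩
  intro r hequi β μ hβ hμ τ hτ hweak S E h α hαE hαS
  haveI : SecondCountableTopology G :=
    (r.continuous.isClosedEmbedding r.injective).isEmbedding.secondCountableTopology
  have hcont : ∀ b : ℝ, Continuous (Summit.QuantumFields.YangMills.Theorems.EquipartitionPinsProbe.plaqField r b) := fun b =>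
    (stub_plaqFieldContinuous G r b).1
  have hmeas : ∀ b : ℝ, Measurable (Summit.QuantumFields.YangMills.Theorems.EquipartitionPinsProbe.plaqField r b) := fun b => (hcont b).measurable
  have hprob : ∀ k, MeasureTheory.IsProbabilityMeasure (μ k) := fun k => by
    obtain ⟨L, -, hP, -⟩ := hμ k
    exact hP
  set ν : ℕ → MeasureTheory.Measure (Literature.MathematicalPhysics.QuantumLattice.ZdPlaquette 4 → Fin (Summit.QuantumFields.YangMills.Theorems.EquipartitionPinsProbe.lieDim r) → ℝ) :=
    fun k => (μ k).map (Summit.QuantumFields.YangMills.Theorems.EquipartitionPinsProbe.plaqField r (β k)) with hν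
  have hνprob : ∀ k, MeasureTheory.IsProbabilityMeasure (ν k) := fun k =>
    MeasureTheory.Measure.isProbabilityMeasure_map (hmeas _).aemeasurable
  -- integrals against the laws are integrals against the states
  have hmap : ∀ (k : ℕ) (f : (Literature.MathematicalPhysics.QuantumLattice.ZdPlaquette 4 → Fin (Summit.QuantumFields.YangMills.Theorems.EquipartitionPinsProbe.lieDim r) → ℝ) → ℝ),
      Continuous f → ∫ Y, f Y ∂(ν k) = ∫ U, f (Summit.QuantumFields.YangMills.Theorems.EquipartitionPinsProbe.plaqField r (β k) U) ∂(μ k) := by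
    intro k f hf
    rw [hν, MeasureTheory.integral_map (hmeas _).aemeasurable hf.measurable.aestronglyMeasurable]
  have hweakν : ∀ f : (Literature.MathematicalPhysics.QuantumLattice.ZdPlaquette 4 → Fin (Summit.QuantumFields.YangMills.Theorems.EquipartitionPinsProbe.lieDim r) → ℝ) → ℝ, Continuous f →
      (∃ C : ℝ, ∀ Y, |f Y| ≤ C) →
      Filter.Tendsto (fun k : ℕ => ∫ Y, f Y ∂(ν k)) Filter.atTop (nhds (∫ Y, f Y ∂τ)) := by
    intro f hf hfb
    refine (hweak f hf hfb).congr' (Filter.Eventually.of_forall fun k => (hmap k f hf).symm)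
  -- uniformly bounded second moments of the laws (STUB TM) and of the tangent law (STUB T2')
  have hmomν : ∀ (p : Literature.MathematicalPhysics.QuantumLattice.ZdPlaquette 4) (a : Fin (Summit.QuantumFields.YangMills.Theorems.EquipartitionPinsProbe.lieDim r)), ∃ C : ℝ, ∀ k : ℕ,
      MeasureTheory.Integrable (fun Y => (Y p a) ^ 2) (ν k) ∧ ∫ Y, (Y p a) ^ 2 ∂(ν k) ≤ C := by
    intro p a
    obtain ⟨C, hC⟩ := stub_fieldMoments G hG r hequi β μ hβ hμ p a
    refine ⟨C, fun k => ?_⟩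
    have hg : Continuous fun Y : Literature.MathematicalPhysics.QuantumLattice.ZdPlaquette 4 → Fin (Summit.QuantumFields.YangMills.Theorems.EquipartitionPinsProbe.lieDim r) → ℝ => (Y p a) ^ 2 :=
      ((continuous_apply a).comp (continuous_apply p)).pow 2
    refine ⟨(MeasureTheory.integrable_map_measure hg.measurable.aestronglyMeasurable
      (hmeas _).aemeasurable).2 (hC k).1, ?_⟩
    rw [hmap k _ hg]
    exact (hC k).2
  have hmomτ := (stub_secondMoments G hG r hequi β μ hβ hμ τ hτ hweak).1
  obtain ⟨B, hB⟩ := hmomτ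
  refine stub_steinReduction (Summit.QuantumFields.YangMills.Theorems.EquipartitionPinsProbe.lieDim r) τ hτ (fun p a => (hB p a).1) ?_ S E h α hαE hαS
  intro S' h' e b hS'
  refine stub_steinSingleEdgeLimit (Summit.QuantumFields.YangMills.Theorems.EquipartitionPinsProbe.lieDim r) ν τ hνprob hτ hweakν hmomν ⟨B, hB⟩ S' h'
    (fun p => Literature.MathematicalPhysics.QuantumFieldTheory.plaquetteCurl (fun e' => if e' = e then (1 : ℝ) else 0) p) b ?_
  intro η hη
  have h1 := stub_steinFiniteBeta G hG r hequi e b S' h' hS' η hη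
  filter_upwards [hβ.eventually h1] with k hk
  have hk' := hk (μ k) (hμ k)
  have hlin : Continuous fun Y : Literature.MathematicalPhysics.QuantumLattice.ZdPlaquette 4 → Fin (Summit.QuantumFields.YangMills.Theorems.EquipartitionPinsProbe.lieDim r) → ℝ =>
      ∑ p ∈ S', ∑ a : Fin (Summit.QuantumFields.YangMills.Theorems.EquipartitionPinsProbe.lieDim r), h' p a * Y p a := by
    refine continuous_finsetSum _ fun p _ => continuous_finsetSum _ fun a _ => ?_
    exact continuous_const.mul ((continuous_apply a).comp (continuous_apply p))
  have hc1 : Continuous fun Y : Literature.MathematicalPhysics.QuantumLattice.ZdPlaquette 4 → Fin (Summit.QuantumFields.YangMills.Theorems.EquipartitionPinsProbe.lieDim r) → ℝ =>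
      Real.sin (∑ p ∈ S', ∑ a : Fin (Summit.QuantumFields.YangMills.Theorems.EquipartitionPinsProbe.lieDim r), h' p a * Y p a) :=
    Real.continuous_sin.comp hlin
  have hc2 : Continuous fun Y : Literature.MathematicalPhysics.QuantumLattice.ZdPlaquette 4 → Fin (Summit.QuantumFields.YangMills.Theorems.EquipartitionPinsProbe.lieDim r) → ℝ =>
      Real.cos (∑ p ∈ S', ∑ a : Fin (Summit.QuantumFields.YangMills.Theorems.EquipartitionPinsProbe.lieDim r), h' p a * Y p a) :=
    Real.continuous_cos.comp hlin
  have hc3 : Continuous fun Y : Literature.MathematicalPhysics.QuantumLattice.ZdPlaquette 4 → Fin (Summit.QuantumFields.YangMills.Theorems.EquipartitionPinsProbe.lieDim r) → ℝ =>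
      ∑ p ∈ S', Literature.MathematicalPhysics.QuantumFieldTheory.plaquetteCurl (fun e' => if e' = e then (1 : ℝ) else 0) p * Y p b :=
    continuous_finsetSum _ fun p _ => continuous_const.mul ((continuous_apply b).comp (continuous_apply p))
  have hc4 : Continuous fun Y : Literature.MathematicalPhysics.QuantumLattice.ZdPlaquette 4 → Fin (Summit.QuantumFields.YangMills.Theorems.EquipartitionPinsProbe.lieDim r) → ℝ =>
      Real.cos (∑ p ∈ S', ∑ a : Fin (Summit.QuantumFields.YangMills.Theorems.EquipartitionPinsProbe.lieDim r), h' p a * Y p a) *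
        ∑ p ∈ S', Literature.MathematicalPhysics.QuantumFieldTheory.plaquetteCurl (fun e' => if e' = e then (1 : ℝ) else 0) p * Y p b :=
    hc2.mul hc3
  have hc5 : Continuous fun Y : Literature.MathematicalPhysics.QuantumLattice.ZdPlaquette 4 → Fin (Summit.QuantumFields.YangMills.Theorems.EquipartitionPinsProbe.lieDim r) → ℝ =>
      Real.sin (∑ p ∈ S', ∑ a : Fin (Summit.QuantumFields.YangMills.Theorems.EquipartitionPinsProbe.lieDim r), h' p a * Y p a) *
        ∑ p ∈ S', Literature.MathematicalPhysics.QuantumFieldTheory.plaquetteCurl (fun e' => if e' = e then (1 : ℝ) else 0) p * Y p b :=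
    hc1.mul hc3
  rw [hmap k _ hc1, hmap k _ hc2, hmap k _ hc4, hmap k _ hc5]
  exact hk'

/-- STUB T_main — **tangent laws of the rescaled plaquette field, with `D = dim 𝔤_r`** (the
compactness half of the local free-gluon law with the number of colours pinned to the route's
`D = dim_ℝ span{X | exp(tX) ∈ r(G) ∀ t}`; THE gauge-theory stub, crux-sized — see the lead's Census):
uniform equipartition ⇒ for all sequences `β_k → ∞`, `μ_k ∈ infiniteVolumeLimitPoints r.ρ β_k`,
there are a subsequence `φ` and a probability measure `τ` on `ZdPlaquette 4 → Fin D → ℝ` with (T0)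
f.d.d. convergence of the rescaled plaquette energies to `½|Y_p|²`, (T1) a.s. closedness, (T2) the
uniform second-moment bound and the budget `∑_{i<j}∑_a E(Y^a_{(0;i,j)})² ≤ 3D`, (T3) the
trigonometric Stein identity. Assets: the exponential chart of `r(G)`
(`Literature.Analysis.Calculus.exists_exp_chart_range`, the sibling crux's `expChart` package),
translation structure of limit points (`map_configShift_mem_infiniteVolumeLimitPoints`), the
one-link Haar shift (p108068). -/
theorem stub_tangentCore :
    ∀ (G : Type) [Group G] [TopologicalSpace G] [IsTopologicalGroup G] [CompactSpace G],
      Literature.MathematicalPhysics.QuantumFieldTheory.IsCompactSimpleLieGroup G →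
      letI : MeasurableSpace G := borel G
      haveI : BorelSpace G := ⟨rfl⟩
      ∀ r : Literature.MathematicalPhysics.QuantumFieldTheory.LatticeRep G,
        (∀ ε : ℝ, 0 < ε → ∀ᶠ β : ℝ in Filter.atTop,
          ∀ μ ∈ Literature.MathematicalPhysics.QuantumLattice.infiniteVolumeLimitPoints
              (d := 4) r.ρ β,
            |β * (∫ U, (∑ i : Fin 4, ∑ j : Fin 4,
                if i < j then ((r.N : ℝ) -
                  Literature.MathematicalPhysics.QuantumLattice.plaquetteObs r.ρ 0 i j U) else 0) ∂μ) -
              3 * (Module.finrank ℝ ↥(Submodule.span ℝ {X : Matrix (Fin r.N) (Fin r.N) ℂ |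
                ∀ t : ℝ, NormedSpace.exp ((t : ℂ) • X) ∈ Set.range r.ρ}) : ℝ) / 2| < ε) →
        ∀ (β : ℕ → ℝ)
            (μ : ℕ → MeasureTheory.Measure (Literature.MathematicalPhysics.QuantumLattice.LGConfig 4 G)),
            Filter.Tendsto β Filter.atTop Filter.atTop →
            (∀ k, μ k ∈ Literature.MathematicalPhysics.QuantumLattice.infiniteVolumeLimitPoints
              (d := 4) r.ρ (β k)) →
            ∃ (φ : ℕ → ℕ) (τ : MeasureTheory.Measure
                (Literature.MathematicalPhysics.QuantumLattice.ZdPlaquette 4 → Fin (Module.finrank ℝ ↥(Submodule.span ℝ {X : Matrix (Fin r.N) (Fin r.N) ℂ | ∀ t : ℝ, NormedSpace.exp ((t : ℂ) • X) ∈ Set.range r.ρ})) → ℝ)),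
              StrictMono φ ∧ MeasureTheory.IsProbabilityMeasure τ ∧
              -- (T0) joint laws of rescaled plaquette energies converge along `φ`
              (∀ (m : ℕ) (p : Fin m → Literature.MathematicalPhysics.QuantumLattice.ZdPlaquette 4)
                  (f : (Fin m → ℝ) → ℝ), Continuous f → (∃ C : ℝ, ∀ v, |f v| ≤ C) →
                Filter.Tendsto (fun j : ℕ => ∫ U, f (fun i => β (φ j) * ((r.N : ℝ) -
                    Literature.MathematicalPhysics.QuantumLattice.plaquetteObs r.ρ
                      (p i).1 (p i).2.1.1 (p i).2.1.2 U)) ∂(μ (φ j)))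
                  Filter.atTop
                  (nhds (∫ Y, f (fun i => (1 / 2 : ℝ) * ∑ a : Fin (Module.finrank ℝ ↥(Submodule.span ℝ {X : Matrix (Fin r.N) (Fin r.N) ℂ | ∀ t : ℝ, NormedSpace.exp ((t : ℂ) • X) ∈ Set.range r.ρ})), (Y (p i) a) ^ 2) ∂τ))) ∧
              -- (T1) `τ` is supported on closed 2-cochains
              (∀ (x : Literature.Probability.LatticeModels.Site 4) (i j k : Fin 4)
                  (hij : i < j) (hjk : j < k) (a : Fin (Module.finrank ℝ ↥(Submodule.span ℝ {X : Matrix (Fin r.N) (Fin r.N) ℂ | ∀ t : ℝ, NormedSpace.exp ((t : ℂ) • X) ∈ Set.range r.ρ}))),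
                ∀ᵐ Y ∂τ,
                  (Y (x + Pi.single i 1, ⟨(j, k), hjk⟩) a - Y (x, ⟨(j, k), hjk⟩) a) -
                    (Y (x + Pi.single j 1, ⟨(i, k), hij.trans hjk⟩) a -
                      Y (x, ⟨(i, k), hij.trans hjk⟩) a) +
                    (Y (x + Pi.single k 1, ⟨(i, j), hij⟩) a - Y (x, ⟨(i, j), hij⟩) a) = 0) ∧
              -- (T2) second moments: uniform bound and the equipartition budget at the origin
              ((∃ B : ℝ, ∀ (p : Literature.MathematicalPhysics.QuantumLattice.ZdPlaquette 4)
                  (a : Fin (Module.finrank ℝ ↥(Submodule.span ℝ {X : Matrix (Fin r.N) (Fin r.N) ℂ | ∀ t : ℝ, NormedSpace.exp ((t : ℂ) • X) ∈ Set.range r.ρ}))),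
                  MeasureTheory.Integrable (fun Y => (Y p a) ^ 2) τ ∧ ∫ Y, (Y p a) ^ 2 ∂τ ≤ B) ∧
                (∑ i : Fin 4, ∑ j : Fin 4, ∑ a : Fin (Module.finrank ℝ ↥(Submodule.span ℝ {X : Matrix (Fin r.N) (Fin r.N) ℂ | ∀ t : ℝ, NormedSpace.exp ((t : ℂ) • X) ∈ Set.range r.ρ})),
                  if hij : i < j then ∫ Y, (Y ((0 : Literature.Probability.LatticeModels.Site 4),
                    ⟨(i, j), hij⟩) a) ^ 2 ∂τ else 0) ≤ 3 * (Module.finrank ℝ ↥(Submodule.span ℝ {X : Matrix (Fin r.N) (Fin r.N) ℂ | ∀ t : ℝ, NormedSpace.exp ((t : ℂ) • X) ∈ Set.range r.ρ}) : ℝ)) ∧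
              -- (T3) the Stein (linearised Schwinger–Dyson) identity, trigonometric form
              (∀ (S : Finset (Literature.MathematicalPhysics.QuantumLattice.ZdPlaquette 4))
                  (E : Finset (Literature.MathematicalPhysics.QuantumLattice.ZdEdge 4))
                  (h : Literature.MathematicalPhysics.QuantumLattice.ZdPlaquette 4 → Fin (Module.finrank ℝ ↥(Submodule.span ℝ {X : Matrix (Fin r.N) (Fin r.N) ℂ | ∀ t : ℝ, NormedSpace.exp ((t : ℂ) • X) ∈ Set.range r.ρ})) → ℝ)
                  (α : Literature.MathematicalPhysics.QuantumLattice.ZdEdge 4 → Fin (Module.finrank ℝ ↥(Submodule.span ℝ {X : Matrix (Fin r.N) (Fin r.N) ℂ | ∀ t : ℝ, NormedSpace.exp ((t : ℂ) • X) ∈ Set.range r.ρ})) → ℝ),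
                (∀ e, e ∉ E → α e = 0) →
                (∀ p, p ∉ S → ∀ a : Fin (Module.finrank ℝ ↥(Submodule.span ℝ {X : Matrix (Fin r.N) (Fin r.N) ℂ | ∀ t : ℝ, NormedSpace.exp ((t : ℂ) • X) ∈ Set.range r.ρ})),
                  Literature.MathematicalPhysics.QuantumFieldTheory.plaquetteCurl
                    (fun e => α e a) p = 0) →
                (∫ Y, Real.cos (∑ p ∈ S, ∑ a : Fin (Module.finrank ℝ ↥(Submodule.span ℝ {X : Matrix (Fin r.N) (Fin r.N) ℂ | ∀ t : ℝ, NormedSpace.exp ((t : ℂ) • X) ∈ Set.range r.ρ})), h p a * Y p a) *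
                    (∑ p ∈ S, ∑ a : Fin (Module.finrank ℝ ↥(Submodule.span ℝ {X : Matrix (Fin r.N) (Fin r.N) ℂ | ∀ t : ℝ, NormedSpace.exp ((t : ℂ) • X) ∈ Set.range r.ρ})),
                      Literature.MathematicalPhysics.QuantumFieldTheory.plaquetteCurl
                        (fun e => α e a) p * Y p a) ∂τ =
                  -(∑ p ∈ S, ∑ a : Fin (Module.finrank ℝ ↥(Submodule.span ℝ {X : Matrix (Fin r.N) (Fin r.N) ℂ | ∀ t : ℝ, NormedSpace.exp ((t : ℂ) • X) ∈ Set.range r.ρ})),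
                      Literature.MathematicalPhysics.QuantumFieldTheory.plaquetteCurl
                        (fun e => α e a) p * h p a) *
                    ∫ Y, Real.sin (∑ p ∈ S, ∑ a : Fin (Module.finrank ℝ ↥(Submodule.span ℝ {X : Matrix (Fin r.N) (Fin r.N) ℂ | ∀ t : ℝ, NormedSpace.exp ((t : ℂ) • X) ∈ Set.range r.ρ})), h p a * Y p a) ∂τ) ∧
                (∫ Y, Real.sin (∑ p ∈ S, ∑ a : Fin (Module.finrank ℝ ↥(Submodule.span ℝ {X : Matrix (Fin r.N) (Fin r.N) ℂ | ∀ t : ℝ, NormedSpace.exp ((t : ℂ) • X) ∈ Set.range r.ρ})), h p a * Y p a) *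
                    (∑ p ∈ S, ∑ a : Fin (Module.finrank ℝ ↥(Submodule.span ℝ {X : Matrix (Fin r.N) (Fin r.N) ℂ | ∀ t : ℝ, NormedSpace.exp ((t : ℂ) • X) ∈ Set.range r.ρ})),
                      Literature.MathematicalPhysics.QuantumFieldTheory.plaquetteCurl
                        (fun e => α e a) p * Y p a) ∂τ =
                  (∑ p ∈ S, ∑ a : Fin (Module.finrank ℝ ↥(Submodule.span ℝ {X : Matrix (Fin r.N) (Fin r.N) ℂ | ∀ t : ℝ, NormedSpace.exp ((t : ℂ) • X) ∈ Set.range r.ρ})),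
                      Literature.MathematicalPhysics.QuantumFieldTheory.plaquetteCurl
                        (fun e => α e a) p * h p a) *
                    ∫ Y, Real.cos (∑ p ∈ S, ∑ a : Fin (Module.finrank ℝ ↥(Submodule.span ℝ {X : Matrix (Fin r.N) (Fin r.N) ℂ | ∀ t : ℝ, NormedSpace.exp ((t : ℂ) • X) ∈ Set.range r.ρ})), h p a * Y p a) ∂τ))  := by
  intro G _ _ _ _ hG
  letI : MeasurableSpace G := borel G
  haveI : BorelSpace G := ⟨rfl⟩
  intro r hequi β μ hβ hμ
  haveI : SecondCountableTopology G :=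
    (r.continuous.isClosedEmbedding r.injective).isEmbedding.secondCountableTopology
  -- the rescaled plaquette field `Y^β = dA^β` (comb gauge) and its laws
  have hcont : ∀ b : ℝ, Continuous (Summit.QuantumFields.YangMills.Theorems.EquipartitionPinsProbe.plaqField r b) := fun b =>
    (stub_plaqFieldContinuous G r b).1
  have hmeas : ∀ b : ℝ, Measurable (Summit.QuantumFields.YangMills.Theorems.EquipartitionPinsProbe.plaqField r b) := fun b => (hcont b).measurable
  have hprob : ∀ k, MeasureTheory.IsProbabilityMeasure (μ k) := fun k => by
    obtain ⟨L, -, hP, -⟩ := hμ k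
    exact hP
  set ν : ℕ → MeasureTheory.Measure (Literature.MathematicalPhysics.QuantumLattice.ZdPlaquette 4 → Fin (Summit.QuantumFields.YangMills.Theorems.EquipartitionPinsProbe.lieDim r) → ℝ) :=
    fun k => (μ k).map (Summit.QuantumFields.YangMills.Theorems.EquipartitionPinsProbe.plaqField r (β k)) with hν
  have hνprob : ∀ k, MeasureTheory.IsProbabilityMeasure (ν k) := fun k =>
    MeasureTheory.Measure.isProbabilityMeasure_map (hmeas _).aemeasurable
  -- uniformly bounded second moments (STUB TM), transported to the laws
  have hmom : ∀ (p : Literature.MathematicalPhysics.QuantumLattice.ZdPlaquette 4) (a : Fin (Summit.QuantumFields.YangMills.Theorems.EquipartitionPinsProbe.lieDim r)), ∃ C : ℝ, ∀ k : ℕ,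
      MeasureTheory.Integrable (fun Y => (Y p a) ^ 2) (ν k) ∧ ∫ Y, (Y p a) ^ 2 ∂(ν k) ≤ C := by
    intro p a
    obtain ⟨C, hC⟩ := stub_fieldMoments G hG r hequi β μ hβ hμ p a
    refine ⟨C, fun k => ?_⟩
    have hg : Continuous fun Y : Literature.MathematicalPhysics.QuantumLattice.ZdPlaquette 4 → Fin (Summit.QuantumFields.YangMills.Theorems.EquipartitionPinsProbe.lieDim r) → ℝ => (Y p a) ^ 2 :=
      ((continuous_apply a).comp (continuous_apply p)).pow 2
    refine ⟨(MeasureTheory.integrable_map_measure hg.measurable.aestronglyMeasurable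
      (hmeas _).aemeasurable).2 (hC k).1, ?_⟩
    rw [hν, MeasureTheory.integral_map (hmeas _).aemeasurable hg.measurable.aestronglyMeasurable]
    exact (hC k).2
  -- extraction of a tangent law (STUB TX)
  obtain ⟨φ, τ, hφ, hτ, hweak⟩ := stub_extraction (Summit.QuantumFields.YangMills.Theorems.EquipartitionPinsProbe.lieDim r) ν hνprob hmom
  have hβφ : Filter.Tendsto (β ∘ φ) Filter.atTop Filter.atTop := hβ.comp hφ.tendsto_atTop
  have hμφ : ∀ k, (μ ∘ φ) k ∈ Literature.MathematicalPhysics.QuantumLattice.infiniteVolumeLimitPoints (d := 4) r.ρ ((β ∘ φ) k) :=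
    fun k => hμ (φ k)
  -- weak convergence read on the configurations
  have hweakμ : ∀ f : (Literature.MathematicalPhysics.QuantumLattice.ZdPlaquette 4 → Fin (Summit.QuantumFields.YangMills.Theorems.EquipartitionPinsProbe.lieDim r) → ℝ) → ℝ, Continuous f →
      (∃ C : ℝ, ∀ Y, |f Y| ≤ C) →
      Filter.Tendsto (fun k : ℕ => ∫ U, f (Summit.QuantumFields.YangMills.Theorems.EquipartitionPinsProbe.plaqField r ((β ∘ φ) k) U) ∂((μ ∘ φ) k))
        Filter.atTop (nhds (∫ Y, f Y ∂τ)) := by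
    intro f hf hfb
    have h := hweak f hf hfb
    refine h.congr' (Filter.Eventually.of_forall fun k => ?_)
    show ∫ Y, f Y ∂((μ (φ k)).map (Summit.QuantumFields.YangMills.Theorems.EquipartitionPinsProbe.plaqField r (β (φ k)))) = _
    rw [MeasureTheory.integral_map (hmeas _).aemeasurable hf.measurable.aestronglyMeasurable]
    rfl
  refine ⟨φ, τ, hφ, hτ, ?_, ?_, ?_, ?_⟩
  · -- (T0): STUB T0' + weak convergence
    intro m p f hf hfb
    obtain ⟨C, hC⟩ := hfb
    have hF : Continuous fun Y : Literature.MathematicalPhysics.QuantumLattice.ZdPlaquette 4 → Fin (Summit.QuantumFields.YangMills.Theorems.EquipartitionPinsProbe.lieDim r) → ℝ =>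
        f (fun i => (1 / 2 : ℝ) * ∑ a : Fin (Summit.QuantumFields.YangMills.Theorems.EquipartitionPinsProbe.lieDim r), (Y (p i) a) ^ 2) := by
      refine hf.comp (continuous_pi fun i => continuous_const.mul ?_)
      exact continuous_finsetSum _ fun a _ => ((continuous_apply a).comp (continuous_apply (p i))).pow 2
    have hlim := hweakμ _ hF ⟨C, fun Y => hC _⟩
    refine hlim.congr_dist ?_
    rw [Metric.tendsto_nhds]
    intro ε hε
    have hev := (stub_energyLaw G hG r hequi m p f hf ⟨C, hC⟩ ε hε)
    filter_upwards [hβφ.eventually hev] with k hk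
    rw [Real.dist_0_eq_abs, abs_of_nonneg dist_nonneg, Real.dist_eq, abs_sub_comm]
    simpa using hk _ (hμφ k)
  · -- (T1): `Y^β = dA^β` is closed for every configuration (STUB TK) and closedness passes to the
    -- limit (STUB TW)
    intro x i j k hij hjk a
    refine stub_closedLimit (Summit.QuantumFields.YangMills.Theorems.EquipartitionPinsProbe.lieDim r) (ν ∘ φ) τ (fun n => hνprob _) hτ hweak x i j k hij hjk a
      fun n => ?_
    show ∀ᵐ Y ∂((μ (φ n)).map (Summit.QuantumFields.YangMills.Theorems.EquipartitionPinsProbe.plaqField r (β (φ n)))), _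
    refine (MeasureTheory.ae_map_iff (hmeas _).aemeasurable ?_).2 (MeasureTheory.ae_of_all _ fun U => ?_)
    · refine (isClosed_eq ?_ continuous_const).measurableSet
      fun_prop
    · exact stub_curlClosed (fun e => Summit.QuantumFields.YangMills.Theorems.EquipartitionPinsProbe.linkField r (β (φ n)) U e a) x i j k hij hjk
  · -- (T2): STUB T2'
    exact stub_secondMoments G hG r hequi (β ∘ φ) (μ ∘ φ) hβφ hμφ τ hτ hweakμ
  · -- (T3): STUB T3'
    exact stub_steinLimit G hG r hequi (β ∘ φ) (μ ∘ φ) hβφ hμφ τ hτ hweakμ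

/-- STUB T (now a theorem of the skeleton) — **tangent laws exist**, from STUB T_a (`stub_liePos`,
`0 < dim 𝔤_r`) and STUB T_main (`stub_tangentCore`). -/
theorem stub_tangent :
    ∀ (G : Type) [Group G] [TopologicalSpace G] [IsTopologicalGroup G] [CompactSpace G],
      Literature.MathematicalPhysics.QuantumFieldTheory.IsCompactSimpleLieGroup G →
      letI : MeasurableSpace G := borel G
      haveI : BorelSpace G := ⟨rfl⟩
      ∀ r : Literature.MathematicalPhysics.QuantumFieldTheory.LatticeRep G,
        (∀ ε : ℝ, 0 < ε → ∀ᶠ β : ℝ in Filter.atTop,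
          ∀ μ ∈ Literature.MathematicalPhysics.QuantumLattice.infiniteVolumeLimitPoints
              (d := 4) r.ρ β,
            |β * (∫ U, (∑ i : Fin 4, ∑ j : Fin 4,
                if i < j then ((r.N : ℝ) -
                  Literature.MathematicalPhysics.QuantumLattice.plaquetteObs r.ρ 0 i j U) else 0) ∂μ) -
              3 * (Module.finrank ℝ ↥(Submodule.span ℝ {X : Matrix (Fin r.N) (Fin r.N) ℂ |
                ∀ t : ℝ, NormedSpace.exp ((t : ℂ) • X) ∈ Set.range r.ρ}) : ℝ) / 2| < ε) →
        ∃ D : ℕ, 0 < D ∧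
          ∀ (β : ℕ → ℝ)
            (μ : ℕ → MeasureTheory.Measure (Literature.MathematicalPhysics.QuantumLattice.LGConfig 4 G)),
            Filter.Tendsto β Filter.atTop Filter.atTop →
            (∀ k, μ k ∈ Literature.MathematicalPhysics.QuantumLattice.infiniteVolumeLimitPoints
              (d := 4) r.ρ (β k)) →
            ∃ (φ : ℕ → ℕ) (τ : MeasureTheory.Measure
                (Literature.MathematicalPhysics.QuantumLattice.ZdPlaquette 4 → Fin D → ℝ)),
              StrictMono φ ∧ MeasureTheory.IsProbabilityMeasure τ ∧
              -- (T0) joint laws of rescaled plaquette energies converge along `φ`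
              (∀ (m : ℕ) (p : Fin m → Literature.MathematicalPhysics.QuantumLattice.ZdPlaquette 4)
                  (f : (Fin m → ℝ) → ℝ), Continuous f → (∃ C : ℝ, ∀ v, |f v| ≤ C) →
                Filter.Tendsto (fun j : ℕ => ∫ U, f (fun i => β (φ j) * ((r.N : ℝ) -
                    Literature.MathematicalPhysics.QuantumLattice.plaquetteObs r.ρ
                      (p i).1 (p i).2.1.1 (p i).2.1.2 U)) ∂(μ (φ j)))
                  Filter.atTop
                  (nhds (∫ Y, f (fun i => (1 / 2 : ℝ) * ∑ a : Fin D, (Y (p i) a) ^ 2) ∂τ))) ∧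
              -- (T1) `τ` is supported on closed 2-cochains
              (∀ (x : Literature.Probability.LatticeModels.Site 4) (i j k : Fin 4)
                  (hij : i < j) (hjk : j < k) (a : Fin D),
                ∀ᵐ Y ∂τ,
                  (Y (x + Pi.single i 1, ⟨(j, k), hjk⟩) a - Y (x, ⟨(j, k), hjk⟩) a) -
                    (Y (x + Pi.single j 1, ⟨(i, k), hij.trans hjk⟩) a -
                      Y (x, ⟨(i, k), hij.trans hjk⟩) a) +
                    (Y (x + Pi.single k 1, ⟨(i, j), hij⟩) a - Y (x, ⟨(i, j), hij⟩) a) = 0) ∧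
              -- (T2) second moments: uniform bound and the equipartition budget at the origin
              ((∃ B : ℝ, ∀ (p : Literature.MathematicalPhysics.QuantumLattice.ZdPlaquette 4)
                  (a : Fin D),
                  MeasureTheory.Integrable (fun Y => (Y p a) ^ 2) τ ∧ ∫ Y, (Y p a) ^ 2 ∂τ ≤ B) ∧
                (∑ i : Fin 4, ∑ j : Fin 4, ∑ a : Fin D,
                  if hij : i < j then ∫ Y, (Y ((0 : Literature.Probability.LatticeModels.Site 4),
                    ⟨(i, j), hij⟩) a) ^ 2 ∂τ else 0) ≤ 3 * D) ∧
              -- (T3) the Stein (linearised Schwinger–Dyson) identity, trigonometric form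
              (∀ (S : Finset (Literature.MathematicalPhysics.QuantumLattice.ZdPlaquette 4))
                  (E : Finset (Literature.MathematicalPhysics.QuantumLattice.ZdEdge 4))
                  (h : Literature.MathematicalPhysics.QuantumLattice.ZdPlaquette 4 → Fin D → ℝ)
                  (α : Literature.MathematicalPhysics.QuantumLattice.ZdEdge 4 → Fin D → ℝ),
                (∀ e, e ∉ E → α e = 0) →
                (∀ p, p ∉ S → ∀ a : Fin D,
                  Literature.MathematicalPhysics.QuantumFieldTheory.plaquetteCurl
                    (fun e => α e a) p = 0) →
                (∫ Y, Real.cos (∑ p ∈ S, ∑ a : Fin D, h p a * Y p a) *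
                    (∑ p ∈ S, ∑ a : Fin D,
                      Literature.MathematicalPhysics.QuantumFieldTheory.plaquetteCurl
                        (fun e => α e a) p * Y p a) ∂τ =
                  -(∑ p ∈ S, ∑ a : Fin D,
                      Literature.MathematicalPhysics.QuantumFieldTheory.plaquetteCurl
                        (fun e => α e a) p * h p a) *
                    ∫ Y, Real.sin (∑ p ∈ S, ∑ a : Fin D, h p a * Y p a) ∂τ) ∧
                (∫ Y, Real.sin (∑ p ∈ S, ∑ a : Fin D, h p a * Y p a) *
                    (∑ p ∈ S, ∑ a : Fin D,
                      Literature.MathematicalPhysics.QuantumFieldTheory.plaquetteCurl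
                        (fun e => α e a) p * Y p a) ∂τ =
                  (∑ p ∈ S, ∑ a : Fin D,
                      Literature.MathematicalPhysics.QuantumFieldTheory.plaquetteCurl
                        (fun e => α e a) p * h p a) *
                    ∫ Y, Real.cos (∑ p ∈ S, ∑ a : Fin D, h p a * Y p a) ∂τ)) := by
  intro G _ _ _ _ hG
  letI : MeasurableSpace G := borel G
  haveI : BorelSpace G := ⟨rfl⟩
  intro r hequi
  exact ⟨_, stub_liePos G hG r, stub_tangentCore G hG r hequi⟩

end Summit.QuantumFields.YangMills.Theorems.EquipartitionPinsProbe

end
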